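import Summits.BirchSwinnertonDyer.BirchSwinnertonDyer.Theorems.SchneiderFreeAdditiveX3PoitouTateReciprocityEqualityHolds
import Literature.NumberTheory.GaloisRepresentations.IdeleBarKSInflationReciprocityClass
import Literature.NumberTheory.GaloisRepresentations.IdeleClassBarKSInvariantInflation
import Literature.NumberTheory.GaloisRepresentations.HomDualIdeleReadoutSExtBidual
import Literature.NumberTheory.GaloisCohomology.RestrictedRamificationUnramifiedClasses
import Literature.NumberTheory.GaloisCohomology.PoitouTateRestrictedShaExtRoad
import Literature.NumberTheory.GaloisRepresentations.TateDualUnramified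
import HarnessLib

/-!
# (R4)_S: the reciprocity law of the `S`-restricted `Ext` road — `inv_S (nat_S y ∘ e ∘ [g_S]) = Σ_{v ∈ S ∪ Ω_∞} ⟨R_v e, y_v⟩_v`
# (Milne *ADT* I Thm. 4.10 (a), proof p. 58, for `G_S`; Tate, C–F VII §11.2 (bis))

Cell `bsd-eis` (run/shared/lean/pub/bsd-eis/), width seat `bsd-line-x1-p1-w5` gen 11; crux 2 `GoodLatticeBDPValue`
(stmt-BirchSwinnertonDyer-19032), line `halves`, background lane «PT-Ш-S-TC», brick D4b / F2d (`F2D-SCOPING-w6g11.md`), routed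
to this seat by LEAD g11 ROUTING #10; `--supports stmt-BirchSwinnertonDyer-19032` (helper).  THEOREMS ONLY (no definition, no
named fact, no instance, no `sorry`).

THE RESULT.  `K` a number field, `S` a finite set of finite places, `Sig = S ∪ Ω_∞ ⊆ Place K`, `M` a finite Galois module killed by
`n ≥ 1` whose Cartier dual `M^D = ρ.tateDual n` is a `G_S`-module (`hur`), `A := ⟨(M^D)^{N_S}⟩ ∈ C_{G_S}` presented by -w7 g11's
`S`-presentation `T_S : 0 → N₁^S → P^S → A → 0`, Harari's class-formation sequence `0 → Ē_S → I_S →g_S C̄_S → 0` (-w6 g11's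
`IdeleClassBar.truncSeqS K S`).  For `e ∈ Ext¹_{C_{G_S}}(A, I_S)` and `y ∈ H¹(G_S, M^D)`:

  **`inv_S ((nat_S y ∘ e) ∘ [g_S]) = zmodToQmodZ n (Σ_{v ∈ Sig} ⟨R_v e, loc_v (inf y)⟩_v)`**   (`invS_natLayerS_comp_comp_truncToClassBarSD`)

with `nat_S = RestrictedExtLayer.natLayerS (ρ.tateDual n) ↑S` (the LAYER bridge, -w5 g11), `R_v = HomDual.readoutSExtB ρ n S hur hn v`
(`-H¹(κ_v) ∘ readoutSExt`, -w6 g11's `S`-readout read on `M` through -w2 g11's inverse biduality `κ`), the pairings through THE canonical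
local invariant maps (`LocalInvariants.canonical K n`), and `inv_S` = -w5 g10's invariant map of `(G_S, C̄_S)`.  In the shape of the
lane's kit (`ShaExtRoad.read`, `ShaExtRoad.idelePart` at `T := truncSeqS K S`, `P := triv ℤ`, `inv := invS S`, `nat := natLayerS`):
**`read_idelePart_eq_sum`** — VERBATIM the binder `hR4` of -w2 g11's `ShaExtRoadKit.natural_at_of_kit'` /
`natural_at_of_idele_class_formation'` at `nat := natLayerS (ρ.tateDual n) S`, `R n M ρ v := readoutSExtB ρ n S _ _ v`,
`linv := LocalInvariants.canonical K`, under the admissibility hypotheses.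

PROOF (Milne p. 58 for `G_S`, made of tree theorems).  `e = δ_S[f]` for some `f : N₁^S ⟶ I_S` (-w6's `bdrySHom_surjective`);
`g_S = (I_S → C_{K_S}) ≫ (C_{K_S} ↠ C̄_S)`; (★1)+(★2) (-w5 g10 / -w6 g11 `invS_comp_mk₀_toClassBarSD_eq_classBarInv`): the value is
`inv_K (Inf X ≫ counit)`; (b)∘(a)∘(d) (-w5 g11 `inflExtHomTriv_natLayerS_bdryS_truncToClassKSD_comp_invariantsInclQuot`): that class is
`Φ⁻¹(inf y) ∘ ∂_T(presSharp f ≫ g)`; door-c5's UNCONDITIONAL all-places reciprocity law `hR4_ideleProjection_of_readoutUnramified` +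
`hRur_holds` for the presented module `M^D`, its canonical biduality pair `(bidual, bidualInv)` (-w2 g11) and the class
`y' = H¹(ι)(inf y)` — whose bridge is `-Φ⁻¹(H¹(κ) y') = -Φ⁻¹(inf y)` — over `T' = Sig ∪ Tf`; the terms off `Sig` vanish
(`readoutS_inr_eq_zero_of_not_mem`; `inf y` is unramified off `S`), and each term over `Sig` is the kit's term by the biduality
transport of the local Tate pairing (`localTatePairingZMod_map_bidualInv_localization`), the two signs cancelling.

HONEST FRAMING: an `Ext`/pairing assembly of tree theorems (the arithmetic is door-c4/c5/c6's reciprocity law and the lane's bricks);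
it is ONE displayed input (`hR4`) of the lane's END theorem, not the END theorem; no summit statement, no case of BSD and no new case of
Poitou–Tate duality is proved here.

References: [MilneADT2006] I Thm. 4.10 (a), proof p. 58, Lemma 4.13, Prop. 0.19; [Harari2020] §17.4 (17.1), Prop. 17.26, §4.3 Rem. 4.24;
[CasselsFrohlichANT1967] VII §11.2 (bis).
-/

noncomputable section

open scoped Classical NumberField ContRepresentation
open Function CategoryTheory CategoryTheory.Abelian NumberField IsDedekindDomain Field
open Literature.Algebra.Homology Literature.Algebra.Homology.DiscreteRep Literature.Algebra.Homology.ExtPresentation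
open Literature.NumberTheory.GaloisRepresentations
open Literature.NumberTheory.GaloisRepresentations.DiscreteGaloisModule
open Literature.NumberTheory.GaloisRepresentations.IdeleClassBar
open Literature.NumberTheory.GaloisRepresentations.FreePresentation
open Literature.NumberTheory.GaloisRepresentations.HomDual
open Literature.NumberTheory.GaloisRepresentations.IdeleReadout (ideleProjection)
open Literature.NumberTheory.GaloisCohomology
open Literature.AnabelianGeometry.AbsoluteAnabelian.Prop121vii (zmodToQmodZ)

set_option linter.dupNamespace false
set_option autoImplicit false

namespace Summit.BirchSwinnertonDyer.BirchSwinnertonDyer.Theorems.PoitouTateReciprocityS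

open Summit.BirchSwinnertonDyer.BirchSwinnertonDyer.Theorems.SchneiderFreeAdditiveX3.PoitouTateReduction
  (hR4_ideleProjection_of_readoutUnramified hRur_holds)

variable {K : Type} [Field K] [NumberField K]
variable {M : Type} [AddCommGroup M] [TopologicalSpace M] [DiscreteTopology M] [Finite M]
variable (ρ : DiscreteGaloisModule K M) (n : ℕ) [NeZero n] [Finite (TateDual K M n)] (hn : ∀ m : M, n • m = 0)
variable (S : Finset (HeightOneSpectrum (𝓞 K)))
  (hur : ramificationSubgroup K (↑S : Set (HeightOneSpectrum (𝓞 K))) ≤ ContinuousRep.ker (ρ.tateDual n))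

/-! ## §1 The inflated class `y' = H¹(ι)(inf y)` is unramified off `S` -/

omit [NeZero n] in
/-- `H¹(ι)(inf y) = inf (H¹(G_S, ι) y)` is inflated from `G_S`, hence unramified at every finite place off `S`.
[cite: Harari2020, §17.2 (p. 290)][cite: MilneADT2006, I §4 (p. 56)] -/
theorem localization_map_bidual_restrictedInf_mem_unramifiedSubgroup [Finite (TateDual K (TateDual K M n) n)]
    (y : restrictedCohomology (ρ.tateDual n) (↑S : Set (HeightOneSpectrum (𝓞 K))) 1)
    {v : HeightOneSpectrum (𝓞 K)} (hv : v ∉ S) :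
    galoisCohomology.localization (((ρ.tateDual n).tateDual n).tateDual n) (Sum.inr v) 1
        (galoisCohomology.map (bidual (ρ.tateDual n) n) 1
          (restrictedInf (ρ.tateDual n) (↑S : Set (HeightOneSpectrum (𝓞 K))) 1 y)) ∈
      unramifiedSubgroup (GaloisRep.toLocal v (((ρ.tateDual n).tateDual n).tateDual n)) 1 := by
  refine localization_mem_unramifiedSubgroup_of_mem_range_restrictedInf _ (S := (↑S : Set (HeightOneSpectrum (𝓞 K))))
    (by simpa using hv) ⟨_, (restrictedInf_map (homOfIntertwining (bidual (ρ.tateDual n) n))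
      (↑S : Set (HeightOneSpectrum (𝓞 K))) 1 y).trans ?_⟩
  exact galoisCohomology.cohomologyMap_ofHom_eq_map _ 1 _

/-- The (positive part of the) bridge of door-c5's all-places law, `Φ⁻¹ ∘ H¹(κ)`, evaluated at `y' = H¹(ι) x`, is `Φ⁻¹ x`
(as a class of `(presentationComplex τ).X₃ = τ` in door-c4's currency). [cite: MilneADT2006, I Prop. 0.19, Thm. 4.10 (proof, p. 58)] -/
theorem extOneEquiv_symm_map_bidualInv_map_bidual {N : Type} [AddCommGroup N] [TopologicalSpace N] [DiscreteTopology N] [Finite N]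
    (τ : DiscreteGaloisModule K N) (n : ℕ) [NeZero n] [Finite (TateDual K N n)] [Finite (TateDual K (TateDual K N n) n)]
    (hN : ∀ m : N, n • m = 0) (x : galoisCohomology τ 1) :
    ((AddMonoidHom.id (Abelian.Ext (triv (Γ := absoluteGaloisGroup K) ℤ) (presentationComplex τ).X₃ 1)).comp
        (((OpenLayer.extOneEquiv τ).symm.toAddMonoidHom).comp (galoisCohomology.map (bidualInv τ n hN) 1)))
        (galoisCohomology.map (bidual τ n) 1 x) =
      (OpenLayer.extOneEquiv τ).symm x := by
  change (OpenLayer.extOneEquiv τ).symm (galoisCohomology.map (bidualInv τ n hN) 1 (galoisCohomology.map (bidual τ n) 1 x)) = _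
  rw [map_bidualInv_map_bidual]

/-! ## §2 The all-places reciprocity law for the presented module `M^D`, read at `y' = H¹(ι)(inf y)` over `Sig` -/

/-- **Door-c5's all-places (R4) for the presented module `M^D` at the class `y' = H¹(ι)(inf y)`, summed over `Sig` only**:
`zmodToQmodZ n (Σ_{v ∈ Sig} ⟨readout_v (presSharp f), loc_v y'⟩_{M^{DD}}) = - inv_K (Φ⁻¹(inf y) ∘ ∂_T(presSharp f ≫ g))`
(the law over `T' = Sig ∪ Tf`; its bridge `-Φ⁻¹(H¹(κ) y')` is `-Φ⁻¹(inf y)`; the terms at the places of `Tf` off `Sig` — finite places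
off `S` — vanish because `readout_v (presSharp f) = readoutS_v f = 0` there). [cite: MilneADT2006, I Thm. 4.10 (a) (proof, p. 58), Lemma 4.13]
[cite: CasselsFrohlichANT1967, Ch. VII §11.2 (bis)] -/
theorem zmodToQmodZ_sum_readout_presSharp_eq_neg_classBarInv
    (Sig : Finset (Place K)) (hSig₁ : ∀ w : InfinitePlace K, (Sum.inl w : Place K) ∈ Sig)
    (hSig₂ : ∀ v : HeightOneSpectrum (𝓞 K), (Sum.inr v : Place K) ∈ Sig ↔ v ∈ S)
    (f : (presentationComplexS (ρ.tateDual n) (↑S : Set (HeightOneSpectrum (𝓞 K)))).X₁ ⟶ truncIdeleBarD K S)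
    (y : restrictedCohomology (ρ.tateDual n) (↑S : Set (HeightOneSpectrum (𝓞 K))) 1) :
    haveI : Finite (TateDual K (TateDual K M n) n) := TateDual.finite K _ n
    zmodToQmodZ n (∑ v ∈ Sig, localTatePairingZMod ((ρ.tateDual n).tateDual n) n v (LocalInvariants.canonical K n v)
        (readout (ρ.tateDual n) n (nsmul_tateDual_eq_zero_of_nsmul n n hn) (ideleProjection K v)
          (presSharp (ρ.tateDual n) S hur f))
        (galoisCohomology.localization (((ρ.tateDual n).tateDual n).tateDual n) v 1
          (galoisCohomology.map (bidual (ρ.tateDual n) n) 1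
            (restrictedInf (ρ.tateDual n) (↑S : Set (HeightOneSpectrum (𝓞 K))) 1 y)))) =
      -classBarInv K (Ext.comp (Y := (presentationComplex (ρ.tateDual n)).X₃)
        ((OpenLayer.extOneEquiv (ρ.tateDual n)).symm (restrictedInf (ρ.tateDual n) (↑S : Set (HeightOneSpectrum (𝓞 K))) 1 y))
        (boundary (presentationComplex_shortExact (ρ.tateDual n)) (classBarD K)
          (presSharp (ρ.tateDual n) S hur f ≫ (ideleClassLimitShortComplex K).g)) (rfl : 1 + 1 = 2)) := by
  classical
  haveI : Finite (TateDual K (TateDual K M n) n) := TateDual.finite K _ n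
  haveI : Finite (TateDual K (TateDual K (TateDual K M n) n) n) := TateDual.finite K _ n
  -- the law for `M^D`, its canonical biduality pair, at `presSharp f`, the class `y'` and `T' = Sig ∪ Tf`
  obtain ⟨Tf, hTf⟩ := hR4_ideleProjection_of_readoutUnramified (ρ.tateDual n) (nsmul_tateDual_eq_zero_of_nsmul n n hn)
    (bidual (ρ.tateDual n) n) (bidualInv (ρ.tateDual n) n (nsmul_tateDual_eq_zero_of_nsmul n n hn))
    (fun g Φ => bidual_apply (ρ.tateDual n) n g Φ) (bidualInv_bidual (ρ.tateDual n) n (nsmul_tateDual_eq_zero_of_nsmul n n hn))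
    (bidual_bidualInv (ρ.tateDual n) n (nsmul_tateDual_eq_zero_of_nsmul n n hn))
    (hRur_holds (ρ.tateDual n) (nsmul_tateDual_eq_zero_of_nsmul n n hn)) (presSharp (ρ.tateDual n) S hur f)
  have hT' := hTf (galoisCohomology.map (bidual (ρ.tateDual n) n) 1
      (restrictedInf (ρ.tateDual n) (↑S : Set (HeightOneSpectrum (𝓞 K))) 1 y)) (Sig ∪ Tf) Finset.subset_union_right
    (fun v hv => localization_map_bidual_restrictedInf_mem_unramifiedSubgroup ρ n S y
      (fun h => hv (Finset.mem_union_left _ ((hSig₂ v).2 h))))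
  -- the bridge of the law at `y'`: `-(Φ⁻¹ (H¹(κ) (H¹(ι) (inf y)))) = -Φ⁻¹(inf y)`
  rw [AddMonoidHom.neg_apply, extOneEquiv_symm_map_bidualInv_map_bidual (ρ.tateDual n) n (nsmul_tateDual_eq_zero_of_nsmul n n hn),
    Ext.neg_comp, map_neg] at hT'
  -- the terms of the law off `Sig` vanish
  refine Eq.trans (congrArg (zmodToQmodZ n) (Finset.sum_subset Finset.subset_union_left fun v _ hv => ?_)) hT'
  obtain ⟨w⟩ | ⟨v₀⟩ := v
  · exact absurd (hSig₁ w) hv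
  · have hv₀ : v₀ ∉ S := fun h => hv ((hSig₂ v₀).2 h)
    rw [← readoutS_apply, readoutS_inr_eq_zero_of_not_mem _ _ _ _ _ hv₀, map_zero, AddMonoidHom.zero_apply]

/-- **Termwise**: the kit's local term `⟨R_v (δ_S[f]), loc_v (inf y)⟩_M` is MINUS the all-places law's term
`⟨readout_v (presSharp f), loc_v (H¹(ι)(inf y))⟩_{M^{DD}}` (`R_v = -H¹(κ_v) ∘ readoutS_v`, biduality transport of the local pairing).
[cite: MilneADT2006, I Thm. 4.10 (a) (proof, p. 58), Prop. 0.19][cite: NeukirchSchmidtWingberg2008, I §4 Prop. (1.4.2)] -/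
theorem localTatePairingZMod_readoutSExtB_bdryS [Finite (TateDual K (TateDual K M n) n)] (v : Place K)
    (inv : galoisCohomology ((mu K n).toLocal v) 2 →+ ZMod n)
    (f : (presentationComplexS (ρ.tateDual n) (↑S : Set (HeightOneSpectrum (𝓞 K)))).X₁ ⟶ truncIdeleBarD K S)
    (y : restrictedCohomology (ρ.tateDual n) (↑S : Set (HeightOneSpectrum (𝓞 K))) 1) :
    localTatePairingZMod ρ n v inv (readoutSExtB ρ n S hur hn v (bdrySHom (ρ.tateDual n) S hur f))
        (restrictedLocalization (ρ.tateDual n) (↑S : Set (HeightOneSpectrum (𝓞 K))) v 1 y) =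
      -localTatePairingZMod ((ρ.tateDual n).tateDual n) n v inv
        (readout (ρ.tateDual n) n (nsmul_tateDual_eq_zero_of_nsmul n n hn) (ideleProjection K v)
          (presSharp (ρ.tateDual n) S hur f))
        (galoisCohomology.localization (((ρ.tateDual n).tateDual n).tateDual n) v 1
          (galoisCohomology.map (bidual (ρ.tateDual n) n) 1
            (restrictedInf (ρ.tateDual n) (↑S : Set (HeightOneSpectrum (𝓞 K))) 1 y))) := by
  rw [readoutSExtB_bdryS]
  -- `⟨-a, b⟩ = -⟨a, b⟩` (term-mode across the seam `ρ.toLocal v = GaloisRep.restrictField K_v ρ`), then the biduality transport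
  have hm := map_neg (localTatePairingZMod ρ n v inv)
    (galoisCohomology.map ((bidualInv ρ n hn).restrictField (Place.Completion v)) 1
      (readoutS (ρ.tateDual n) n S hur (nsmul_tateDual_eq_zero_of_nsmul n n hn) v f))
  refine (DFunLike.congr_fun hm _).trans ?_
  rw [AddMonoidHom.neg_apply]
  exact congrArg Neg.neg (localTatePairingZMod_map_bidualInv_localization ρ n hn v inv _ _)

/-! ## §3 (R4)_S on a boundary class `e = δ_S[f]` -/

/-- **(R4)_S on a boundary class.**  For `f : N₁^S ⟶ I_S` and `y ∈ H¹(G_S, M^D)`: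
`inv_S ((nat_S y ∘ δ_S[f]) ∘ [g_S]) = zmodToQmodZ n (Σ_{v ∈ Sig} ⟨R_v (δ_S[f]), loc_v (inf y)⟩_v)`, `R_v = readoutSExtB`.
[cite: MilneADT2006, I Thm. 4.10 (a) (proof, p. 58), Lemma 4.13, Prop. 0.19][cite: CasselsFrohlichANT1967, Ch. VII §11.2 (bis)]
[cite: Harari2020, Prop. 17.26, §4.3 Remark 4.24] -/
theorem invS_natLayerS_bdryS_truncToClassBarSD
    (Sig : Finset (Place K)) (hSig₁ : ∀ w : InfinitePlace K, (Sum.inl w : Place K) ∈ Sig)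
    (hSig₂ : ∀ v : HeightOneSpectrum (𝓞 K), (Sum.inr v : Place K) ∈ Sig ↔ v ∈ S)
    (f : (presentationComplexS (ρ.tateDual n) (↑S : Set (HeightOneSpectrum (𝓞 K)))).X₁ ⟶ truncIdeleBarD K S)
    (y : restrictedCohomology (ρ.tateDual n) (↑S : Set (HeightOneSpectrum (𝓞 K))) 1) :
    invS S ((((RestrictedExtLayer.natLayerS (ρ.tateDual n) (↑S : Set (HeightOneSpectrum (𝓞 K))) y).comp
        (bdrySHom (ρ.tateDual n) S hur f) (rfl : 1 + 1 = 2)).comp (Ext.mk₀ (truncToClassBarSD K S)) (add_zero 2))) =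
      zmodToQmodZ n (∑ v ∈ Sig, localTatePairingZMod ρ n v (LocalInvariants.canonical K n v)
        (readoutSExtB ρ n S hur hn v (bdrySHom (ρ.tateDual n) S hur f))
        (restrictedLocalization (ρ.tateDual n) (↑S : Set (HeightOneSpectrum (𝓞 K))) v 1 y)) := by
  classical
  haveI : Finite (TateDual K (TateDual K M n) n) := TateDual.finite K _ n
  -- Step 1 ((★1)+(★2), then (b)∘(a)∘(d)): the left-hand side is `inv_K (Φ⁻¹(inf y) ∘ ∂_T(presSharp f ≫ g))`
  have h1 : invS S ((((RestrictedExtLayer.natLayerS (ρ.tateDual n) (↑S : Set (HeightOneSpectrum (𝓞 K))) y).comp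
        (bdrySHom (ρ.tateDual n) S hur f) (rfl : 1 + 1 = 2)).comp (Ext.mk₀ (truncToClassBarSD K S)) (add_zero 2))) =
      classBarInv K (Ext.comp (Y := (presentationComplex (ρ.tateDual n)).X₃)
        ((OpenLayer.extOneEquiv (ρ.tateDual n)).symm (restrictedInf (ρ.tateDual n) (↑S : Set (HeightOneSpectrum (𝓞 K))) 1 y))
        (boundary (presentationComplex_shortExact (ρ.tateDual n)) (classBarD K)
          (presSharp (ρ.tateDual n) S hur f ≫ (ideleClassLimitShortComplex K).g)) (rfl : 1 + 1 = 2)) := by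
    rw [truncToClassBarSD_eq_comp, ← Ext.mk₀_comp_mk₀, ← Ext.comp_assoc_of_third_deg_zero,
      invS_comp_mk₀_toClassBarSD_eq_classBarInv]
    exact congrArg (classBarInv K)
      (inflExtHomTriv_natLayerS_bdryS_truncToClassKSD_comp_invariantsInclQuot (ρ.tateDual n) S hur f y)
  -- Step 2: the all-places law at `y'` over `Sig` (§2), and termwise the kit's term is MINUS the law's term
  have h2 := zmodToQmodZ_sum_readout_presSharp_eq_neg_classBarInv ρ n hn S hur Sig hSig₁ hSig₂ f y
  rw [h1, ← neg_eq_iff_eq_neg.mpr h2, ← map_neg, ← Finset.sum_neg_distrib]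
  exact congrArg (zmodToQmodZ n) (Finset.sum_congr rfl fun v _ =>
    (localTatePairingZMod_readoutSExtB_bdryS ρ n hn S hur v (LocalInvariants.canonical K n v) f y).symm)

/-! ## §4 (R4)_S for every class, and in the kit's shape -/

/-- **(R4)_S**: `inv_S ((nat_S y ∘ e) ∘ [g_S]) = zmodToQmodZ n (Σ_{v ∈ Sig} ⟨R_v e, loc_v (inf y)⟩_v)` for EVERY
`e ∈ Ext¹_{C_{G_S}}(⟨(M^D)^{N_S}⟩, I_S)` (`δ_S` is onto, -w6 g11). [cite: MilneADT2006, I Thm. 4.10 (a) (proof, p. 58), Lemma 4.13]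
[cite: CasselsFrohlichANT1967, Ch. VII §11.2 (bis)] -/
theorem invS_natLayerS_comp_comp_truncToClassBarSD
    (Sig : Finset (Place K)) (hSig₁ : ∀ w : InfinitePlace K, (Sum.inl w : Place K) ∈ Sig)
    (hSig₂ : ∀ v : HeightOneSpectrum (𝓞 K), (Sum.inr v : Place K) ∈ Sig ↔ v ∈ S)
    (e : Ext (presentationComplexS (ρ.tateDual n) (↑S : Set (HeightOneSpectrum (𝓞 K)))).X₃ (truncIdeleBarD K S) 1)
    (y : restrictedCohomology (ρ.tateDual n) (↑S : Set (HeightOneSpectrum (𝓞 K))) 1) :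
    invS S ((((RestrictedExtLayer.natLayerS (ρ.tateDual n) (↑S : Set (HeightOneSpectrum (𝓞 K))) y).comp e
        (rfl : 1 + 1 = 2)).comp (Ext.mk₀ (truncToClassBarSD K S)) (add_zero 2))) =
      zmodToQmodZ n (∑ v ∈ Sig, localTatePairingZMod ρ n v (LocalInvariants.canonical K n v)
        (readoutSExtB ρ n S hur hn v e)
        (restrictedLocalization (ρ.tateDual n) (↑S : Set (HeightOneSpectrum (𝓞 K))) v 1 y)) := by
  obtain ⟨f, rfl⟩ := bdrySHom_surjective (ρ.tateDual n) S hur e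
  exact invS_natLayerS_bdryS_truncToClassBarSD ρ n hn S hur Sig hSig₁ hSig₂ f y

/-- **(R4)_S in the kit's shape** — VERBATIM the binder `hR4` of `ShaExtRoadKit.natural_at_of_kit'` /
`natural_at_of_idele_class_formation'` (after its admissibility hypotheses), with `T := IdeleClassBar.truncSeqS K S`, `P := triv ℤ`,
`inv := IdeleClassBar.invS S`, `nat := RestrictedExtLayer.natLayerS (ρ.tateDual n) ↑S`, `R v := HomDual.readoutSExtB ρ n S hur hn v`,
`linv := LocalInvariants.canonical K`: `read (idelePart e) y = zmodToQmodZ n (Σ_{v ∈ Sig} ⟨R_v e, loc_v y⟩_v)`.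
[cite: MilneADT2006, I Thm. 4.10 (a) (proof, p. 58), Lemma 4.13][cite: Harari2020, Prop. 17.26, §17.5] -/
theorem read_idelePart_eq_sum
    (Sig : Finset (Place K)) (hSig₁ : ∀ w : InfinitePlace K, (Sum.inl w : Place K) ∈ Sig)
    (hSig₂ : ∀ v : HeightOneSpectrum (𝓞 K), (Sum.inr v : Place K) ∈ Sig ↔ v ∈ S)
    (e : Ext (ofContinuousRep ((ρ.tateDual n).quotientInvariants (ramificationSubgroup K (↑S : Set (HeightOneSpectrum (𝓞 K))))))
      (truncIdeleBarD K S) 1)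
    (y : restrictedCohomology (ρ.tateDual n) (↑S : Set (HeightOneSpectrum (𝓞 K))) 1) :
    ShaExtRoad.read ρ (↑S : Set (HeightOneSpectrum (𝓞 K))) (T := truncSeqS K S)
        (ofContinuousRep ((ρ.tateDual n).quotientInvariants (ramificationSubgroup K (↑S : Set (HeightOneSpectrum (𝓞 K))))))
        (triv ℤ) (invS S) (RestrictedExtLayer.natLayerS (ρ.tateDual n) (↑S : Set (HeightOneSpectrum (𝓞 K))))
        (ShaExtRoad.idelePart (T := truncSeqS K S)
          (ofContinuousRep ((ρ.tateDual n).quotientInvariants (ramificationSubgroup K (↑S : Set (HeightOneSpectrum (𝓞 K)))))) e)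
        y =
      zmodToQmodZ n (∑ v ∈ Sig, localTatePairingZMod ρ n v (LocalInvariants.canonical K n v)
        (readoutSExtB ρ n S hur hn v e)
        (restrictedLocalization (ρ.tateDual n) (↑S : Set (HeightOneSpectrum (𝓞 K))) v 1 y)) := by
  rw [ShaExtRoad.read_apply]
  change invS S ((RestrictedExtLayer.natLayerS (ρ.tateDual n) (↑S : Set (HeightOneSpectrum (𝓞 K))) y).comp
      (e.comp (Ext.mk₀ (truncToClassBarSD K S)) (add_zero 1)) (rfl : 1 + 1 = 2)) = _
  rw [← Ext.comp_assoc_of_third_deg_zero]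
  exact invS_natLayerS_comp_comp_truncToClassBarSD ρ n hn S hur Sig hSig₁ hSig₂ e y

omit [NeZero n] [Finite (TateDual K M n)] in
/-- **The kit's admissibility hypotheses make `M^D` a `G_S`-module**: `N_S ≤ ker (ρ.tateDual n)` from "`M` unramified outside `S`"
and "`v ∣ #M ⇒ v ∈ S`" (-w2 g11's `isUnramifiedOutside_tateDual_of_natCard`) — the binder `hur` of the theorems above, for the closer.
[cite: MilneADT2006, Ch. I §0 (the module `M^D`), Thm. 4.10][cite: Harari2020, Remark 17.7 (b)] -/
theorem ramificationSubgroup_le_ker_tateDual (hurM : GaloisRep.IsUnramifiedOutside (↑S : Set (HeightOneSpectrum (𝓞 K))) ρ)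
    (hS : ∀ v : HeightOneSpectrum (𝓞 K), ((Nat.card M : ℕ) : 𝓞 K) ∈ v.asIdeal → v ∈ (↑S : Set (HeightOneSpectrum (𝓞 K)))) :
    ramificationSubgroup K (↑S : Set (HeightOneSpectrum (𝓞 K))) ≤ ContinuousRep.ker (ρ.tateDual n) :=
  (isUnramifiedOutside_iff_ramificationSubgroup_le_ker (ρ.tateDual n) _).1 (isUnramifiedOutside_tateDual_of_natCard ρ hS hurM n)

end Summit.BirchSwinnertonDyer.BirchSwinnertonDyer.Theorems.PoitouTateReciprocityS

end
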